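import Summits.HodgeConjecture.HodgeConjecture.Cruxes.BlochSeedDiscOne.FineAxisLift
import Summits.HodgeConjecture.HodgeConjecture.Cruxes.BlochSeedDiscOne.ShellThreeClosed

/-!
# FineAxisLiftShell3 — the SHELL-3 PLATE WITH TWO DISPLAYED BINDERS behind the fine door (hsemireg-sheaf8-1 g7 draft edfe671911ffc033, landed by g9 once `ShellThreeClosed` ∕ `FineAxisLift` were built on the hub, 2026-08-31; three-line composition leaf)

Token: line stmt-HodgeConjecture-18881 Cruxes/BlochSeedDiscOne/Lines/birth.lean 814a6a70c14e831a stub_rung_pad4_seedAt.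
`ShellThreeClosed.shell3_empty_of_binders (B) (Bu) (M2)` (dual g17) with (Bu) `NoOffHubfreeP` DISCHARGED from (M2) `NHubbed` behind the fine door by
`FineAxisLift.noOffHubfreeP_of_nHubbed` (v1.1 a4234562335568f8): the plate needs (B) `HubfreePB`, (M2) `NHubbed h` and the fine door `RuleDPFine`
(part of the statement of record v4.3, displayed because `DeepLayerLaws.RingRoomB` carries only the coarse `RuleD`).  LETTER-MODEL BOOKKEEPING ONLY;
nothing here is proved toward HC ∕ HC_CM ∕ HC_AV ∕ №4 ∕ 26512 ∕ 18881 ∕ H2.  No `sorry` ∕ axiom ∕ `instance` ∕ `decide`.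
-/

set_option linter.dupNamespace false
set_option autoImplicit false

namespace Summit.HodgeConjecture.HodgeConjecture.Cruxes.BlochSeedDiscOne.FineAxisLiftShell3

open Summit.HodgeConjecture.HodgeConjecture.Cruxes.BlochSeedDiscOne.DepthBoundA4
open Summit.HodgeConjecture.HodgeConjecture.Cruxes.BlochSeedDiscOne.LeggedFloor (RuleD Disj)
open Summit.HodgeConjecture.HodgeConjecture.Cruxes.BlochSeedDiscOne.FineDoorRing2 (RuleDPFine)
open Summit.HodgeConjecture.HodgeConjecture.Cruxes.BlochSeedDiscOne.BoxCap (NHubbed)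
open Summit.HodgeConjecture.HodgeConjecture.Cruxes.BlochSeedDiscOne.HallB136 (HallUp)
open Summit.HodgeConjecture.HodgeConjecture.Cruxes.BlochSeedDiscOne.RuleDPlate (HallPlusUp BudgetClause)
open Summit.HodgeConjecture.HodgeConjecture.Cruxes.BlochSeedDiscOne.DeepLayerLaws (RingLe RingRoomB RingShellB ringShellB_of_ringRoomB)
open Summit.HodgeConjecture.HodgeConjecture.Cruxes.BlochSeedDiscOne.SigmaH (sigmaH diag_le_sigmaH)
open Summit.HodgeConjecture.HodgeConjecture.Cruxes.BlochSeedDiscOne.ShellThreeFloorB (HubfreePB NoOffHubfreeP)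
open Summit.HodgeConjecture.HodgeConjecture.Cruxes.BlochSeedDiscOne.ShellThreeClosed (shell3_empty_of_binders)
open Summit.HodgeConjecture.HodgeConjecture.Cruxes.BlochSeedDiscOne.FineAxisLift (noOffHubfreeP_of_nHubbed)

variable {h : ℤ} {D : Design}

/-- **THE SHELL-3 PLATE WITH TWO BINDERS behind the fine door:** (B), (M2), `RuleDPFine`, the coarse hypotheses of `ShellThreeClosed` ⟹ `False`. -/
theorem shell3_empty_of_two_binders (σ : Design → ℤ) (hσ : 28 * (D.copies : ℤ) ≤ σ D)
    (hB : HubfreePB D) (hM2 : NHubbed h D)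
    (hD : D.OnAlphabet h) (hdis : Disj D) (h1 : D.A1) (hr : RuleD D) (hfine : RuleDPFine D) (hp : HallPlusUp D 8) (hμ : D.mu ≠ 0)
    (hb : BudgetClause σ 0 D) (hR : RingLe 3 D) : False :=
  shell3_empty_of_binders σ hσ hB (noOffHubfreeP_of_nHubbed hD hdis hfine hM2) hM2 hD hdis h1 hr hp hμ hb hR

/-- the two-binder plate in the currency of record `σ_H`. -/
theorem shell3_empty_of_two_binders_sigmaH (hB : HubfreePB D) (hM2 : NHubbed h D)
    (hD : D.OnAlphabet h) (hdis : Disj D) (h1 : D.A1) (hr : RuleD D) (hfine : RuleDPFine D) (hp : HallPlusUp D 8) (hμ : D.mu ≠ 0)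
    (hb : BudgetClause sigmaH 0 D) (hR : RingLe 3 D) : False :=
  shell3_empty_of_two_binders sigmaH (diag_le_sigmaH D) hB hM2 hD hdis h1 hr hfine hp hμ hb hR

/-- (B), (M2) and the fine door as one predicate. -/
def BindersFine (h : ℤ) (D : Design) : Prop := HubfreePB D ∧ NHubbed h D ∧ RuleDPFine D

/-- ROOM 3 is closed for the budget clause of any `σ ≥ 28·copies` if (B), (M2) and the fine door hold on every design of room 3. -/
theorem ringRoom_three_closed_of_two_binders (h : ℤ) (σ : Design → ℤ) (hσ : ∀ D : Design, 28 * (D.copies : ℤ) ≤ σ D)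
    (H : ∀ D : Design, D.OnAlphabet h → Disj D → D.A1 → RuleD D → HallUp D → HallPlusUp D 8 → D.mu ≠ 0 →
      BudgetClause σ 0 D → RingLe 3 D → BindersFine h D) :
    RingRoomB h (BudgetClause σ 0) 3 := by
  intro D hD hdis h1 hr hu hp hμ hb hR
  obtain ⟨hB, hM2, hfine⟩ := H D hD hdis h1 hr hu hp hμ hb hR
  exact shell3_empty_of_two_binders σ (hσ D) hB hM2 hD hdis h1 hr hfine hp hμ hb hR

/-- SHELL 3 likewise, and in the currency of record. -/
theorem shell_three_closed_of_two_binders (h : ℤ) (σ : Design → ℤ) (hσ : ∀ D : Design, 28 * (D.copies : ℤ) ≤ σ D)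
    (H : ∀ D : Design, D.OnAlphabet h → Disj D → D.A1 → RuleD D → HallUp D → HallPlusUp D 8 → D.mu ≠ 0 →
      BudgetClause σ 0 D → RingLe 3 D → BindersFine h D) :
    RingShellB h (BudgetClause σ 0) 3 :=
  ringShellB_of_ringRoomB (ringRoom_three_closed_of_two_binders h σ hσ H)

theorem shell_three_closed_sigmaH_of_two_binders (h : ℤ)
    (H : ∀ D : Design, D.OnAlphabet h → Disj D → D.A1 → RuleD D → HallUp D → HallPlusUp D 8 → D.mu ≠ 0 →
      BudgetClause sigmaH 0 D → RingLe 3 D → BindersFine h D) :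
    RingShellB h (BudgetClause sigmaH 0) 3 :=
  shell_three_closed_of_two_binders h sigmaH diag_le_sigmaH H

end Summit.HodgeConjecture.HodgeConjecture.Cruxes.BlochSeedDiscOne.FineAxisLiftShell3
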